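import Summits.Ventures.CertifiedArithmetic.LowPrec.GemmFirstRegimeE2M1
import Summits.Ventures.CertifiedArithmetic.LowPrec.GemmPrecRoundingG
import HarnessLib

/-!
# GEMM worst case LXII-a — the FIRST REGIME of `W_p(n)` for EVERY product alphabet on a dyadic
# grid, every precision: the exact range `n ≤ n₀(p)` and the restart bound `W_p(n₀+k) ≤ ku/(1+ku)`

HONEST FRAMING: certified error envelopes and provably optimal rounding/accumulation schemes for
low-precision formats under stated cost models; every table by two implementations; no hardware or
vendor claims.

File LXI-a (`GemmFirstRegimeE2M1`) did this for the one alphabet `Π(E2M1,E2M1) ⊂ ¼ℤ`.  Here the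
alphabet is ABSTRACT: the terms are `x j = z_j / 2^G` with integers `|z_j| ≤ M`, and `z_j` odd only
when `|z_j| ≤ m₀` (`1 ≤ m₀ ≤ M`).  Every product alphabet of the cell has this shape (grid `2^-G`,
largest letter `M`, largest odd letter `m₀`; file LXII-c):
`E2M1²: (2,144,9)`, `E2M3²: (6,3600,225)`, `E3M2²: (8,200704,49)`, `E2M3·E2M1: (4,720,45)`,
`E3M2·E2M1: (5,5376,21)`, `E3M2·E2M3: (7,26880,105)`.  Write `T = 2^(manBits φ + 1)` (`= 2^p`)
and let `j₀` satisfy `M·j₀ + m₀ < T`; the largest such `j₀` is `n₀(p) - 1`,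
`n₀(p) = ⌊(T-1-m₀)/M⌋ + 1`.  For every format `φ` with `qexp φ ≤ -G`, `M ≤ T`, `M ≤ 2^(G+E)` and
`2^(manBits φ + E + 3) ≤ maxRat φ` (binary32 meets them for all six alphabets):

* `seqSum_exact_prefixG` — THE EXACT RANGE: every partial sum of at most `n₀` terms is computed
  exactly (a partial sum of `j+1` terms is, in grid units, even of size `≤ M(j+1) < 2T` or of size
  `≤ Mj + m₀ < T` — `KZ_shapeG` — and both kinds lie in `F_φ`, `grid_repr`);
* `relErr_le_firstRegimeG` — THE RESTART BOUND: `R(x, n₀+k) ≤ k/(T+k)` (`= ku/(1+ku)`, `u = 2^{-p}`)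
  for `k ≤ 2^{p-1}`: from term `n₀` on the computation is recursive summation of the `k+1` members
  `s_{n₀}, x_{n₀+1}, …, x_{n₀+k}` of `F_φ`, so Lange–Rump [BoldoEtAl2023, Thm 4.5] applies, in the
  data-only range form `abs_seqSum_sub_sum_le_langeRump_of_sum_le` of file LXI-a.
File LXII-b (`GemmFirstRegimeGridLaw`) gives the entry words (attainment, plateau, late and deficient
entry); file LXII-c (`GemmFirstRegimeAlphabets`) the six alphabets and their binary32 rows.

Method: the precision AND the alphabet are symbols; representability by the grid bridge
`exists_toRat_eq_grid_prec` (file `GemmPrecRoundingG`) and the Jeannerod–Rump bridge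
`exists_toRat_eq_of_isFloat`.  References: [BoldoEtAl2023, Thm 4.5], [LangeRump2019] (restart
bound); [Higham2002, §4.2], [MullerEtAl2018HFPA, §6.1]; [RouhaniEtAl2023MX, Table 1] (the formats);
the exact first regime of a fixed product alphabet in every precision is not in print to our
knowledge (FRESHNESS-GEMM.md, gen 15/16 presearch).
-/

namespace Summit.Ventures.CertifiedArithmetic.LowPrec.Gemm

open Literature.ComputerArithmetic.FloatingPoint
open Literature.ComputerArithmetic.FloatingPoint.MiniFloat
open Literature.ComputerArithmetic.JeannerodRump2018
open Finset

variable {φ : Format}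

/-- `emaxCode ≥ 2` for every format holding `2^(manBits+1)` whose quantum is `≤ 1`. [folklore] -/
theorem two_le_emaxCode_of_le (hq : φ.qexp ≤ 0) (hR : (2 : ℚ) ^ (φ.manBits + 1) ≤ φ.maxRat) :
    2 ≤ φ.emaxCode := by
  by_contra h
  have hms : φ.maxScaled < 2 ^ (φ.manBits + 1) := by
    rcases Nat.lt_or_ge φ.emaxCode 1 with h0 | h1
    · rw [Format.maxScaled_eq_topMan (by omega)]
      exact lt_of_lt_of_le φ.topMan_lt (Nat.pow_le_pow_right (by norm_num) (by omega))
    · have h1' : φ.emaxCode = 1 := by omega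
      have := Format.maxScaled_lt_pow (φ := φ) h1
      rwa [h1'] at this
  have hquant : φ.quantum ≤ 1 := by
    unfold Format.quantum
    calc (2 : ℚ) ^ φ.qexp ≤ 2 ^ (0 : ℤ) := zpow_le_zpow_right₀ (by norm_num) hq
      _ = 1 := zpow_zero _
  have hlt : φ.maxRat < 2 ^ (φ.manBits + 1) := by
    unfold Format.maxRat
    have hms' : (φ.maxScaled : ℚ) < 2 ^ (φ.manBits + 1) := by exact_mod_cast hms
    calc (φ.maxScaled : ℚ) * φ.quantum ≤ φ.maxScaled * 1 :=
          mul_le_mul_of_nonneg_left hquant (Nat.cast_nonneg _)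
      _ < 2 ^ (φ.manBits + 1) := by rw [mul_one]; exact hms'
  linarith

section Grid

variable {G M m0 E : ℕ}

/-! ### Grid values and letters are values of `φ` -/

section Repr

variable (hq : φ.qexp ≤ -(G : ℤ)) (hR : (2 : ℚ) ^ (φ.manBits + E + 3) ≤ φ.maxRat)
include hq hR

/-- GRID VALUES ARE VALUES OF `φ`: `K/2^G` with `|K| < T`, or `K` even with `|K| < 2T`
(`T = 2^(manBits+1)`), when the grid lies in the exponent range. [folklore] -/
theorem grid_repr {K : ℤ}
    (h : K.natAbs < 2 ^ (φ.manBits + 1) ∨ (K % 2 = 0 ∧ K.natAbs < 2 ^ (φ.manBits + 2))) :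
    ∃ y : MiniFloat φ, y.toRat = (K : ℚ) / 2 ^ G := by
  have hR' : (2 : ℚ) ^ (φ.manBits + (E + 3)) ≤ φ.maxRat := by rwa [← add_assoc]
  have hT2 : 2 ^ (φ.manBits + 2) = 2 * 2 ^ (φ.manBits + 1) := by ring
  have hKlt : K.natAbs < 2 ^ (φ.manBits + (E + 3) + G) := by
    have : 2 ^ (φ.manBits + 2) ≤ 2 ^ (φ.manBits + (E + 3) + G) :=
      Nat.pow_le_pow_right (by norm_num) (by omega)
    rcases h with h | ⟨_, h⟩ <;> omega
  have hrange := grid_le_maxRat_of_lt hR' hKlt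
  rcases h with h | ⟨hev, hlt⟩
  · exact exists_toRat_eq_grid_prec hq h hrange
  · obtain ⟨c, hc⟩ : ∃ c, K = 2 * c := ⟨K / 2, by omega⟩
    have hcabs : c.natAbs < 2 ^ (φ.manBits + 1) := by omega
    refine exists_toRat_eq_of_isFloat ⟨c, -(G : ℤ) + 1, ?_, by omega, ?_⟩ ?_
    · rw [Int.abs_eq_natAbs]; exact_mod_cast hcabs
    · have h2G : (2 : ℚ) ^ (-(G : ℤ) + 1) = 2 / 2 ^ G := by
        rw [zpow_add₀ (by norm_num : (2 : ℚ) ≠ 0), zpow_neg, zpow_natCast, zpow_one]; ring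
      rw [hc, h2G]; push_cast; ring
    · rw [abs_div, abs_of_pos (by positivity : (0 : ℚ) < 2 ^ G), ← Int.cast_abs,
        Int.abs_eq_natAbs, Int.cast_natCast]
      exact hrange

/-- Every grid letter `z/2^G`, `|z| ≤ M ≤ T`, is a value of `φ`. [cell] -/
theorem letter_reprG (hMT : M ≤ 2 ^ (φ.manBits + 1)) {z : ℤ} (hz : z.natAbs ≤ M) :
    ∃ y : MiniFloat φ, y.toRat = (z : ℚ) / 2 ^ G := by
  refine grid_repr hq hR ?_
  rcases Nat.lt_or_ge z.natAbs (2 ^ (φ.manBits + 1)) with h | h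
  · exact Or.inl h
  · right
    have he : z.natAbs = 2 ^ (φ.manBits + 1) := le_antisymm (le_trans hz hMT) h
    refine ⟨Int.even_iff.mp (Int.natAbs_even.mp ?_), ?_⟩
    · rw [he]; exact Nat.even_pow.mpr ⟨even_two, by omega⟩
    · rw [he]; exact Nat.pow_lt_pow_right (by norm_num) (by omega)

end Repr

/-! ### Words over a grid alphabet `(G, M, m₀)`: partial sums in grid units -/

/-- A grid letter in lowest terms: `(2^G·(z/2^G)).num = z`. [folklore] -/
theorem num_two_pow_mul_div (z : ℤ) : ((2 : ℚ) ^ G * ((z : ℚ) / 2 ^ G)).num = z := by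
  have h : (2 : ℚ) ^ G * ((z : ℚ) / 2 ^ G) = z := by field_simp
  rw [h]; exact Rat.num_intCast z

variable {x : ℕ → ℚ}
  (hx : ∀ j, ∃ z : ℤ, x j = (z : ℚ) / 2 ^ G ∧ z.natAbs ≤ M ∧ (z % 2 = 0 ∨ z.natAbs ≤ m0))
include hx

/-- The letter `x j` in grid units: `x j = (2^G x j).num / 2^G`, `|(2^G x j).num| ≤ M`, odd only
when `≤ m₀`. [cell] -/
theorem letter_numG (j : ℕ) : x j = ((((2 : ℚ) ^ G * x j).num : ℤ) : ℚ) / 2 ^ G ∧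
    ((2 : ℚ) ^ G * x j).num.natAbs ≤ M ∧
    (((2 : ℚ) ^ G * x j).num % 2 = 0 ∨ ((2 : ℚ) ^ G * x j).num.natAbs ≤ m0) := by
  obtain ⟨z, hz, hM, hpar⟩ := hx j
  rw [hz, num_two_pow_mul_div]
  exact ⟨rfl, hM, hpar⟩

/-- `Σ_{i≤j} xᵢ = (Σ_{i≤j} (2^G xᵢ).num)/2^G`: the partial sum in grid units. [cell] -/
theorem sum_eq_KZG (j : ℕ) : ∑ i ∈ range (j + 1), x i
    = ((∑ i ∈ range (j + 1), ((2 : ℚ) ^ G * x i).num : ℤ) : ℚ) / 2 ^ G := by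
  push_cast; rw [div_eq_mul_inv, Finset.sum_mul]
  exact sum_congr rfl (fun i _ => ((letter_numG hx i).1).trans (div_eq_mul_inv _ _))

/-- SHAPE OF A PARTIAL SUM of `j+1` letters in grid units (`m₀ ≤ M`): even and of size `≤ M(j+1)`,
or (an odd letter was used) of size `≤ Mj + m₀`. [cell, gemm.tex Prop. p:fpA (i)] -/
theorem KZ_shapeG (hm0M : m0 ≤ M) :
    ∀ j, ((∑ i ∈ range (j + 1), ((2 : ℚ) ^ G * x i).num) % 2 = 0 ∧
        (∑ i ∈ range (j + 1), ((2 : ℚ) ^ G * x i).num).natAbs ≤ M * (j + 1)) ∨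
      (∑ i ∈ range (j + 1), ((2 : ℚ) ^ G * x i).num).natAbs ≤ M * j + m0
  | 0 => by
      have h := letter_numG hx 0
      simp only [zero_add, range_one, sum_singleton, mul_one, mul_zero]
      omega
  | j + 1 => by
      have ih := KZ_shapeG hm0M j
      have h := letter_numG hx (j + 1)
      have e1 : M * (j + 1 + 1) = M * (j + 1) + M := by ring
      have e2 : M * (j + 1) = M * j + M := by ring
      rw [sum_range_succ _ (j + 1)]
      omega

section Regime

variable (hq : φ.qexp ≤ -(G : ℤ)) (hR : (2 : ℚ) ^ (φ.manBits + E + 3) ≤ φ.maxRat)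
  (hm0M : m0 ≤ M) (hMT : M ≤ 2 ^ (φ.manBits + 1)) (hm0 : 1 ≤ m0) (hME : M ≤ 2 ^ (G + E))
include hq hR hm0M hMT

omit hm0M in
/-- Every letter is a value of `φ`. [cell] -/
theorem letter_reprG' (j : ℕ) : ∃ y : MiniFloat φ, y.toRat = x j := by
  obtain ⟨z, hz, hM, _⟩ := hx j
  rw [hz]; exact letter_reprG hq hR hMT hM

/-- Every partial sum of at most `n₀` letters (`j ≤ j₀`, `M j₀ + m₀ < T`) is a value of `φ`. [cell] -/
theorem sum_reprG {j0 : ℕ} (hj0 : M * j0 + m0 < 2 ^ (φ.manBits + 1)) (j : ℕ) (hj : j ≤ j0) :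
    ∃ y : MiniFloat φ, y.toRat = ∑ i ∈ range (j + 1), x i := by
  rw [sum_eq_KZG hx]
  have hT2 : 2 ^ (φ.manBits + 2) = 2 * 2 ^ (φ.manBits + 1) := by ring
  refine grid_repr hq hR ?_
  rcases KZ_shapeG hx hm0M j with ⟨hev, hle⟩ | hle
  · right; refine ⟨hev, ?_⟩
    have h1 : M * (j + 1) ≤ M * (j0 + 1) := Nat.mul_le_mul_left _ (by omega)
    have h2 : M * (j0 + 1) = M * j0 + M := by ring
    omega
  · left
    have h1 : M * j ≤ M * j0 := Nat.mul_le_mul_left _ hj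
    omega

/-- THE EXACT RANGE, every precision and every grid alphabet: `ŝ_j = s_j` for every word and every
`j ≤ j₀` (`M j₀ + m₀ < T`), i.e. every inner product of at most `n₀(p)` products accumulated
sequentially in `φ` is exact. [cell, gemm.tex Prop. p:fpA (i)] -/
theorem seqSum_exact_prefixG {j0 : ℕ} (hj0 : M * j0 + m0 < 2 ^ (φ.manBits + 1)) :
    ∀ j ≤ j0, (seqSum φ x j).toRat = ∑ i ∈ range (j + 1), x i
  | 0, _ => by
      simp only [seqSum, zero_add, range_one, sum_singleton]
      have h := sum_reprG hx hq hR hm0M hMT hj0 0 (Nat.zero_le _)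
      simp only [zero_add, range_one, sum_singleton] at h
      exact toRat_roundNE_of_exists h
  | j + 1, hj => by
      simp only [seqSum]
      rw [seqSum_exact_prefixG hj0 j (by omega), ← sum_range_succ]
      exact toRat_roundNE_of_exists (sum_reprG hx hq hR hm0M hMT hj0 (j + 1) hj)

/-- `R(x, m) = 0` for every word of at most `n₀` letters (`M m + m₀ < T`). [cell, gemm.tex Prop. p:fpA (i)] -/
theorem relErr_eq_zero_prefixG {m : ℕ} (hm : M * m + m0 < 2 ^ (φ.manBits + 1)) :
    relErr φ x m = 0 := by
  unfold relErr
  rw [seqSum_exact_prefixG hx hq hR hm0M hMT hm m le_rfl, sub_self, abs_zero, zero_div]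

/-! ### The restart bound `R(x, n₀ + k) ≤ k/(T + k)` -/

omit hq hR hm0M hMT in
/-- Mass of letters: `Σ_{i<n} |xᵢ| ≤ (M/2^G)·n`. [cell] -/
theorem sum_abs_leG (n : ℕ) : ∑ i ∈ range n, |x i| ≤ (M : ℚ) / 2 ^ G * n := by
  have hle : ∀ i, |x i| ≤ (M : ℚ) / 2 ^ G := by
    intro i
    obtain ⟨z, hz, hM, _⟩ := hx i
    rw [hz, abs_div, abs_of_pos (by positivity : (0 : ℚ) < 2 ^ G), ← Int.cast_abs,
      Int.abs_eq_natAbs, Int.cast_natCast]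
    exact div_le_div_of_nonneg_right (by exact_mod_cast hM) (by positivity)
  calc ∑ i ∈ range n, |x i| ≤ ∑ _i ∈ range n, (M : ℚ) / 2 ^ G := sum_le_sum fun i _ => hle i
    _ = (M : ℚ) / 2 ^ G * n := by rw [sum_const, card_range, nsmul_eq_mul, mul_comm]

include hm0 hME in
/-- THE RESTART BOUND, every precision and every grid alphabet: for every word and
`k ≤ 2^manBits = ½u⁻¹`, `R(x, j₀+k) ≤ k/(T+k)` (`= ku/(1+ku)`) whenever `M j₀ + m₀ < T`: after the
exact prefix the computation is recursive summation of `k+1` values of `φ`, and Lange–Rump applies.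
[cell, gemm.tex Prop. p:fpA (ii); BoldoEtAl2023 Thm 4.5] -/
theorem relErr_le_firstRegimeG {j0 : ℕ} (hj0 : M * j0 + m0 < 2 ^ (φ.manBits + 1)) {k : ℕ}
    (hk : k ≤ 2 ^ φ.manBits) :
    relErr φ x (j0 + k) ≤ (k : ℚ) / (2 ^ (φ.manBits + 1) + k) := by
  have hα : 2 ≤ φ.emaxCode :=
    two_le_emaxCode_of_le (by omega) (le_trans (pow_le_pow_right₀ (by norm_num) (by omega)) hR)
  set S := ∑ i ∈ range (j0 + 1), x i with hS
  set y : ℕ → ℚ := fun i => if i = 0 then S else x (j0 + i) with hy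
  have hy0 : y 0 = S := by simp [hy]
  have hys : ∀ i, y (i + 1) = x (j0 + (i + 1)) := fun i => by simp [hy]
  -- the shifted accumulation
  have hstart : seqSum φ x j0 = roundNE φ S := by
    rcases Nat.eq_zero_or_pos j0 with h0 | hpos
    · subst h0; simp [seqSum, hS]
    · obtain ⟨j, rfl⟩ : ∃ j, j0 = j + 1 := ⟨j0 - 1, by omega⟩
      simp only [seqSum]
      rw [seqSum_exact_prefixG hx hq hR hm0M hMT hj0 j (by omega), hS,
        sum_range_succ (fun i => x i) (j + 1)]
  have hshift : ∀ i, seqSum φ x (j0 + i) = seqSum φ y i := by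
    intro i
    induction i with
    | zero => rw [Nat.add_zero, hstart]; simp [seqSum, hy0]
    | succ i ih =>
        show roundNE φ ((seqSum φ x (j0 + i)).toRat + x (j0 + i + 1)) =
          roundNE φ ((seqSum φ y i).toRat + y (i + 1))
        rw [ih, hys]
        rfl
  -- hypotheses of Lange–Rump for `y`
  have hSrep : ∃ z : MiniFloat φ, z.toRat = S := sum_reprG hx hq hR hm0M hMT hj0 j0 le_rfl
  have hyrep : ∀ i ≤ k, ∃ z : MiniFloat φ, z.toRat = y i := by
    intro i _
    rcases i with _ | i
    · rw [hy0]; exact hSrep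
    · rw [hys]; exact letter_reprG' hx hq hR hMT _
  have hT : (2 : ℚ) ^ (φ.manBits + 1) = 2 * 2 ^ φ.manBits := by ring
  have hkq : (k : ℚ) ≤ 2 ^ φ.manBits := by exact_mod_cast hk
  have hM1 : 1 ≤ M := le_trans hm0 hm0M
  have hj0T : j0 < 2 ^ (φ.manBits + 1) := by
    have : j0 ≤ M * j0 := Nat.le_mul_of_pos_left _ hM1
    omega
  have hj0q : (j0 : ℚ) < 2 ^ (φ.manBits + 1) := by exact_mod_cast hj0T
  have hu : φ.unitRoundoff = 1 / 2 ^ (φ.manBits + 1) := Format.unitRoundoff_eq φ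
  have hupos := φ.unitRoundoff_pos
  have h2pos : (0 : ℚ) < 2 ^ φ.manBits := by positivity
  have hku : 2 * (k : ℚ) * φ.unitRoundoff ≤ 1 := by
    rw [hu, hT]; field_simp; linarith
  -- masses
  have hmassy : ∑ i ∈ range (k + 1), |y i| ≤ ∑ i ∈ range (j0 + k + 1), |x i| := by
    have h1 : |S| ≤ ∑ i ∈ range (j0 + 1), |x i| := abs_sum_le_sum_abs _ _
    have h2 : ∑ i ∈ range k, |x (j0 + (i + 1))| = ∑ i ∈ range k, |x (j0 + 1 + i)| :=
      sum_congr rfl fun i _ => by rw [show j0 + (i + 1) = j0 + 1 + i by ring]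
    rw [sum_range_succ', hy0, show j0 + k + 1 = (j0 + 1) + k by ring,
      sum_range_add (fun i => |x i|) (j0 + 1) k]
    simp only [hys]
    linarith
  have hmassx := sum_abs_leG hx (j0 + k + 1)
  have hsum : (1 + (k : ℚ) * (φ.unitRoundoff / (1 + φ.unitRoundoff)))
      * ∑ i ∈ range (k + 1), |y i| ≤ φ.maxRat := by
    have hfac : (k : ℚ) * (φ.unitRoundoff / (1 + φ.unitRoundoff)) ≤ 1 := by
      have h1 : φ.unitRoundoff / (1 + φ.unitRoundoff) ≤ φ.unitRoundoff :=
        div_le_self hupos.le (by linarith)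
      calc (k : ℚ) * (φ.unitRoundoff / (1 + φ.unitRoundoff)) ≤ k * φ.unitRoundoff :=
            mul_le_mul_of_nonneg_left h1 (Nat.cast_nonneg k)
        _ ≤ 1 := by linarith
    have hpos : 0 ≤ ∑ i ∈ range (k + 1), |y i| := sum_nonneg fun i _ => abs_nonneg _
    have hMq : (M : ℚ) / 2 ^ G ≤ 2 ^ E := by
      rw [div_le_iff₀ (by positivity : (0 : ℚ) < 2 ^ G), ← pow_add, add_comm]
      exact_mod_cast hME
    have hcnt : ((j0 + k + 1 : ℕ) : ℚ) ≤ 4 * 2 ^ φ.manBits := by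
      have h1 : (1 : ℚ) ≤ 2 ^ φ.manBits := one_le_pow₀ (by norm_num)
      push_cast; linarith
    have hbig : 2 * ((M : ℚ) / 2 ^ G * ((j0 + k + 1 : ℕ) : ℚ)) ≤ 2 ^ (φ.manBits + E + 3) := by
      have e : (2 : ℚ) ^ (φ.manBits + E + 3) = 2 * (2 ^ E * (4 * 2 ^ φ.manBits)) := by ring
      rw [e]
      have := mul_le_mul hMq hcnt (Nat.cast_nonneg _) (by positivity)
      linarith
    calc (1 + (k : ℚ) * (φ.unitRoundoff / (1 + φ.unitRoundoff))) * ∑ i ∈ range (k + 1), |y i|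
        ≤ 2 * ∑ i ∈ range (k + 1), |y i| := mul_le_mul_of_nonneg_right (by linarith) hpos
      _ ≤ φ.maxRat := by linarith
  have hLR := abs_seqSum_sub_sum_le_langeRump_of_sum_le hα y k hyrep hsum hku
  -- back to `x`
  have hsumy : ∑ i ∈ range (k + 1), y i = ∑ i ∈ range (j0 + k + 1), x i := by
    have h2 : ∑ i ∈ range k, x (j0 + (i + 1)) = ∑ i ∈ range k, x (j0 + 1 + i) :=
      sum_congr rfl fun i _ => by rw [show j0 + (i + 1) = j0 + 1 + i by ring]
    rw [sum_range_succ', hy0, show j0 + k + 1 = (j0 + 1) + k by ring, sum_range_add x (j0 + 1) k,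
      hS]
    simp only [hys]
    linarith
  have hcoef : (k : ℚ) * φ.unitRoundoff / (1 + (k : ℚ) * φ.unitRoundoff)
      = (k : ℚ) / (2 ^ (φ.manBits + 1) + k) := by
    rw [hu]; field_simp
  unfold relErr
  rw [hshift, ← hsumy]
  rw [hcoef] at hLR
  have hcnn : (0 : ℚ) ≤ (k : ℚ) / (2 ^ (φ.manBits + 1) + k) := by positivity
  by_cases hL : ∑ i ∈ range (j0 + k + 1), |x i| = 0
  · rw [hL, div_zero]; exact hcnn
  · have hLpos : 0 < ∑ i ∈ range (j0 + k + 1), |x i| :=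
      lt_of_le_of_ne (sum_nonneg fun i _ => abs_nonneg _) (Ne.symm hL)
    rw [div_le_iff₀ hLpos]
    exact le_trans hLR (mul_le_mul_of_nonneg_left hmassy hcnn)

end Regime

end Grid

end Summit.Ventures.CertifiedArithmetic.LowPrec.Gemm
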